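import Mathlib.Analysis.SpecialFunctions.Trigonometric.Basic
import Literature.Probability.LatticeModels.SixVertexHeightModel

/-!
# The closed-collar `Δ = -1/2` height model of the Baxter–Kelland–Wu coupling on a finite domain of
# `ℤ²`, with wired arcs and leg insertions (`CollarLegModel`)

Definition request `defn-CollarLegModel` (route `CriticalPhenomena/CardyFormulaZ2/CardyBoundaryCoulombGas`,
cruxes `BoundaryDefectGaussianR`, `MarkDensityDictionary`). The Baxter–Kelland–Wu (BKW) coupling
[BaxterKellandWu1976] maps bond percolation on a finite graph `(V, E) ⊂ ℤ²` (`p = 1/2`, `q = 1`) to an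
ice-type model on its medial graph: every bond configuration `ω ⊆ E` becomes a fully packed family
of loops on the medial lattice; orienting the loops and giving every `±90°` turn of a strand the
phase `e^{±iμ}`, `μ = π/12`, gives every closed loop the weight `e^{4iμ} + e^{-4iμ} = 2cos(π/3) = 1`
(so the complex partition function IS `Z_perc = 2^{|E|}`), and summing the two pairings at a live
edge produces the six-vertex weights `a = b = 1`, `c = e^{2iμ} + e^{-2iμ} = √3`, `Δ = -1/2` — the
setting of DKLM's Theorem 8 in the full plane [DKLM2026SixVertexGFF, §2.1, §3.2: `2πμ_DKLM =
arccos(√q/2) = π/3 = 4μ` at `q = 1`]. Oriented loops are the level lines of a HEIGHT function on the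
cells of the medial lattice = vertices AND faces of `ℤ²`, changing by `±1` across every strand.

This file is the finite-volume, boundary version the route needs, in height language, with every
convention of the request pinned:

* **(A) cells / heights.** `V : Finset (ℤ × ℤ)`; live edges `E` = lattice edges with both ends in
  `V`; exterior edges = exactly one end in `V` (frozen CLOSED); faces = unit squares indexed by their
  bottom-left corner (`SixVertex.faces`, `SixVertex.bdryFaces`); interior face = all four corners in
  `V` (free), every other face with a corner in `V` is a COLLAR cell with a prescribed height
  (`CollarData.faceH`; the homogeneous closed collar `CollarData.free 0`). A height configuration
  gives an integer to every free cell, and `|h x - h f| = 1` for every vertex-cell `x` and face-cell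
  `f` sharing a corner (ice rule built in; arrow reversal is `h ↦ -h` about the collar level).
* **(B) live weight** at `e = {x, y} ∈ E` with side faces `f, g`: `√3` if `h x = h y ∧ h f = h g`
  (c-type), else `1` (`liveWeight`).
* **(C) collar phase** at an exterior edge `{v, w}` (`v ∈ V`): `e^{iμ (h v − H)}` if its two faces
  carry the same height `H`; **(D1) jump edge**: faces at heights differing by `2` (then `h v` is
  forced in between): factor `1` — two legs (level lines) end there (`closedWeight`).
* **(D2) wired arcs.** Dirichlet vertices `arc ⊆ V` at prescribed (odd) height, one GHOST vertex-cell
  outside each of them (and at the outer corner of a corner pocket), spokes `{v, g_v}` and ghost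
  edges frozen OPEN; the exterior faces enclosed by them are POCKETS (free faces); a frozen open edge
  `{x, y}` gives, for each of its side faces `f` that is a cell, the factor `e^{iμ (h f − h x)}`
  (`openWeight`: `e^{±2iμ}` / `1` at a spoke, `e^{iμ(h p − H_w)}` at the ghost edge under a pocket).
  All four rules are the two instances (frozen closed / frozen open medial vertex) of ONE rule: a
  tracked strand turning by `±90°` contributes `e^{±iμ}`, an inconsistently oriented pairing between
  two prescribed cells is a defect (legs end, factor `1`).
* `Z (M) = ∑_h ∏ live weights · ∏ frozen factors : ℂ` over the finite set of height configurations.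
* **(D3) leg insertions** (`LegInsertionData`, `LegInsertionData.collar`, `Zins`): sources `x_i`
  with leg numbers `L_i ≥ 1` and one sink (leg number `Σ L_i`, so `Σ s_i L_i = 0`) at non-corner
  boundary vertices; the collar is built by walking the exterior darts counter-clockwise from the
  sink: the prescribed level drops by `L_i` over the footprint of a source and rises by `Σ L_i` over
  that of the sink, odd units through free/wired JUNCTIONS (a stretch is wired iff its level is odd;
  level `-Σ L_i` just before the sink), even units through jump edges (D1); an insertion occupies
  `⌈L/2⌉` (`+1` for an even insertion met on a wired stretch, which closes the arc and reopens it)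
  consecutive exterior darts starting at its own.

## Validation (exact enumeration, this seat; scripts `py/collar*.py` in the session folder)

With these definitions: `Z = 2^{|E|}` for the closed collar on the boxes `1×1, 2×1, 2×2, 3×2, 3×3`,
two L-shapes and two plus-shapes (e.g. `Z(1×1) = e^{iπ/3} + e^{-iπ/3} = 1`, `Z(2×1) = 2`); and for leg
insertions `|Zins| = #{ω ⊆ E : rainbow event}` with a configuration-independent argument in
`(π/12)ℤ`, in 106 placements on boxes `4×2 … 6×2, 4×3`, an L-, a U- and a staircase shape (arcs
through convex and reflex corners included): `(2;2) ↔ {x ↔ y}` (the request's value `593` on the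
`4×2` box with `x = (1,0)`, `y = (2,0)` is reproduced), `(1,1;2) ↔ {x ↔ [a,b]}`, `(1,1,1;3) ↔
{x' ↔ [a,b]} ∩ {[c,x] ↮ [a,b]}` (`x'` the boundary vertex after `x`, `[a,b]` = the Dirichlet
vertices of the wired arc). The three failures seen are placements whose two-dart sink footprint
runs up a width-one spike — excluded by `LegInsertionData.IsAdmissible`-style hypotheses in any
scaling statement (points off corners). These identities and `Z = 2^{|E|}` are THEOREMS about the
definitions below, to be proved where needed; they are not stated here as facts.

## Design / faithfulness notes

* Everything combinatorial is computable (`Finset (ℤ × ℤ)`); only the `ℂ`-valued weights are not.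
* Height configurations are functions on the free cells with values in `[-B, B]`,
  `B = CollarLegModel.bound` (sum of the sup of `|prescribed heights|`, `2|V|` and `2`); the bound is
  redundant (every free cell is within `2|V| + 2` unit steps of a prescribed cell along a north-east
  diagonal), it only makes finiteness manifest.
* Constraints `|h x − h f| = 1` are imposed for corner pairs with at least one FREE cell; two
  prescribed cells may disagree (that is exactly what a jump edge is).
* Reflex corners of the domain inside a wired stretch carry no exterior edge, hence no spoke: they
  stay free (joined to the wired arc through their two live boundary edges); the corner face at a
  convex corner inside a wired stretch is a pocket whose outer corner is a ghost. Both choices are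
  the ones for which the enumeration identities above hold exactly.
* Junk: a `CollarLegModel` with inconsistent data simply has few/no configurations; a sink without
  an exterior edge gives the closed collar `CollarData.free 0`; overlapping footprints overwrite.
* NOT here: the percolation dictionary and `Z = 2^{|E|}` as theorems, the phase normalisation
  `e^{-iθ}` of `Zins` (its argument is configuration-independent by the validation above; the crux
  divides it out), infinite-volume / half-plane versions, DKLM's Theorem 8 (a full-plane statement
  about the same weights `a = b = 1`, `c = √3`, already vendored as
  `SixVertex.DKLM2026_sixVertex_heightFunction_GFF`).

## References

* R. J. Baxter, S. B. Kelland, F. Y. Wu, *Equivalence of the Potts model or Whitney polynomial with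
  an ice-type model*, J. Phys. A 9 (1976) 397–406 (medial-lattice ice model of the Whitney
  polynomial with its boundary weights; `q = 1`: loop weight `1`). [BaxterKellandWu1976]
* H. Duminil-Copin, K. K. Kozlowski, P. Lammers, I. Manolescu, arXiv:2603.06268 (2026), §2.1
  (weights `a = b = 1`, `c ∈ [√3, 2]`), §3.2 (BKW loop phases `2πμ = arccos(√q/2)`), Thm. 8.
  [DKLM2026SixVertexGFF]
* J. Kondev, Phys. Rev. Lett. 78 (1997) 4320 (background charge = boundary turning of level
  lines). [Kondev1997]
* Ledger item `defn-CollarLegModel` (2026-08-15) and its attachment `SPEC-CollarLegInsertions.md`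
  (planner, route CardyBoundaryCoulombGas): the pinned conventions (A)–(D).
-/

namespace Literature.Probability.LatticeModels

open Finset

namespace CollarLegModel

/-! ### Lattice bookkeeping on `ℤ²` (edges as in `SixVertex.edges`: `(u,false)` = `u → u+e₁`,
`(u,true)` = `u → u+e₂`; faces indexed by bottom-left corners as in `SixVertex.faces`) -/

/-- The live edges `E` of a finite `V ⊂ ℤ²`: lattice edges with both endpoints in `V`. [cite: BaxterKellandWu1976, medial-lattice ice model (bulk)] -/
def inducedEdges (V : Finset (ℤ × ℤ)) : Finset ((ℤ × ℤ) × Bool) :=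
  (SixVertex.edges V).filter fun e => e.1 ∈ V ∧ SixVertex.edgeTip e ∈ V

/-- The interior faces of `V`: unit squares with all four corners in `V` (the free face-cells of
the closed collar). [cite: BaxterKellandWu1976, medial-lattice ice model (bulk)] -/
def interiorFaces (V : Finset (ℤ × ℤ)) : Finset (ℤ × ℤ) :=
  (SixVertex.faces V).filter fun f => SixVertex.faceCorners f ⊆ V

/-- The four lattice neighbours of a vertex. [folklore] -/
def neighbours (v : ℤ × ℤ) : Finset (ℤ × ℤ) :=
  {(v.1 + 1, v.2), (v.1, v.2 + 1), (v.1 - 1, v.2), (v.1, v.2 - 1)}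

/-- The four edges of the face with bottom-left corner `f` (bottom, left, top, right). [folklore] -/
def faceEdges (f : ℤ × ℤ) : Finset ((ℤ × ℤ) × Bool) :=
  {(f, false), (f, true), ((f.1, f.2 + 1), false), ((f.1 + 1, f.2), true)}

/-- The unit phase per `90°` turn of an oriented strand: `e^{iμk}`, `μ = π/12`; four turns of a
closed loop give `e^{±iπ/3}` (loop weight `2cos(π/3) = 1` at `q = 1`), the two turns of the two
pairings at a c-type edge give `e^{2iμ} + e^{-2iμ} = √3 = c`. [cite: DKLM2026SixVertexGFF, §3.2] -/
noncomputable def phase (k : ℤ) : ℂ :=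
  Complex.exp ((((k : ℝ) * (Real.pi / 12) : ℝ) : ℂ) * Complex.I)

/-- A **collar domain**: a finite vertex set `V ⊂ ℤ²` (the route's `Ω̄ ∩ δℤ²` in lattice units, `Ω`
a bounded axis-parallel rectilinear polygon; nothing here needs that shape). [folklore] -/
abbrev CollarDomain : Type := Finset (ℤ × ℤ)

/-- The collar domain of a finite set of sites `Fin 2 → ℤ` (`LatticeModels.Site 2`, the vertex type
of the percolation files `meshDomain` / `discreteCrossing`), read in coordinates. [folklore] -/
def CollarDomain.ofSites (s : Finset (Fin 2 → ℤ)) : CollarDomain :=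
  s.image fun x => (x 0, x 1)

/-- **Collar data** on a domain `V`: prescribed heights `faceH` of the collar (exterior, non-pocket)
faces and `vertH` of the Dirichlet arc vertices and ghost vertices, the set `arc` of Dirichlet
(wired-arc) vertices and the set `pocket` of exterior faces left free (pockets of wired arcs).
Values of `faceH`/`vertH` away from those cells are irrelevant. (The data structure of the requesting route's
"jump collar"; the homogeneous closed collar is BKW's free boundary.) [folklore] -/
structure CollarData where
  /-- prescribed height of a collar face (indexed by its bottom-left corner) -/
  faceH : ℤ × ℤ → ℤ
  /-- prescribed height of a Dirichlet arc vertex / ghost vertex -/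
  vertH : ℤ × ℤ → ℤ
  /-- the Dirichlet (wired-arc) vertices -/
  arc : Finset (ℤ × ℤ)
  /-- the exterior faces that are pockets (free) -/
  pocket : Finset (ℤ × ℤ)

/-- The homogeneous CLOSED collar at height `H` (free boundary conditions of bond percolation: all
exterior edges closed, no wired arc): every collar face at height `H`. [cite: BaxterKellandWu1976, medial-lattice ice model (boundary weights)] -/
def CollarData.free (H : ℤ) : CollarData where
  faceH := fun _ => H
  vertH := fun _ => 0
  arc := ∅
  pocket := ∅

end CollarLegModel

/-- **The closed-collar `Δ = -1/2` height model with wired arcs / leg insertions** (BKW coupling of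
bond percolation at `p = 1/2` in height form) on the finite vertex set `V ⊂ ℤ²` with collar data
`C`: see the module docstring for the cells, constraints and weights. [cite: BaxterKellandWu1976, medial-lattice ice model] -/
structure CollarLegModel where
  /-- the vertex set `V ⊂ ℤ²` (route: `V = Ω̄ ∩ δℤ²` rescaled to `ℤ²`) -/
  V : CollarLegModel.CollarDomain
  /-- the collar: prescribed exterior heights, wired arcs, pockets -/
  C : CollarLegModel.CollarData

namespace CollarLegModel

/-- A **collar domain** is a finite vertex set of `ℤ²`; the model with the homogeneous closed
collar at height `0` on it. [cite: BaxterKellandWu1976, medial-lattice ice model (boundary weights)] -/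
def ofDomain (V : Finset (ℤ × ℤ)) : CollarLegModel :=
  ⟨V, CollarData.free 0⟩

variable (M : CollarLegModel)

/-! ### Cells -/

/-- Live edges of the model. [cite: BaxterKellandWu1976, medial-lattice ice model (bulk)] -/
def E : Finset ((ℤ × ℤ) × Bool) := inducedEdges M.V

/-- The pockets: declared pocket faces that are exterior faces of `V`. [folklore] -/
def pockets : Finset (ℤ × ℤ) := M.C.pocket ∩ SixVertex.bdryFaces M.V

/-- The Dirichlet arc vertices lying in `V`. [folklore] -/
def arcVerts : Finset (ℤ × ℤ) := M.C.arc ∩ M.V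

/-- Ghost vertices: lattice points outside `V` adjacent to an arc vertex, or a corner of a pocket
(this adds the outer corner of a corner pocket). They are vertex-cells at prescribed height. [folklore] -/
def ghosts : Finset (ℤ × ℤ) :=
  (M.arcVerts.biUnion neighbours ∪ M.pockets.biUnion SixVertex.faceCorners) \ M.V

/-- Vertex-cells: `V` and the ghosts. [folklore] -/
def vertexCells : Finset (ℤ × ℤ) := M.V ∪ M.ghosts

/-- Free vertex-cells: vertices of `V` off the Dirichlet arcs. [folklore] -/
def freeVerts : Finset (ℤ × ℤ) := M.V \ M.C.arc

/-- Face-cells: all faces with a corner in `V` (interior faces, collar faces, pockets). [folklore] -/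
def faceCells : Finset (ℤ × ℤ) := SixVertex.faces M.V

/-- Free face-cells: interior faces and pockets. [folklore] -/
def freeFaces : Finset (ℤ × ℤ) := interiorFaces M.V ∪ M.pockets

/-- The free cells, tagged `false` = vertex, `true` = face; a height configuration is a function on
this finite set. [folklore] -/
def freeCells : Finset ((ℤ × ℤ) × Bool) :=
  (M.freeVerts.image fun x => (x, false)) ∪ (M.freeFaces.image fun f => (f, true))

/-- Frozen medial vertices: lattice edges at a vertex-cell that are not live (exterior edges,
spokes, ghost edges, …). [cite: BaxterKellandWu1976, medial-lattice ice model (boundary weights)] -/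
def frozenEdges : Finset ((ℤ × ℤ) × Bool) := SixVertex.edges M.vertexCells \ M.E

/-- The frozen OPEN edges: spokes (arc vertex — ghost) and the edges of pockets with no endpoint in
`V` (ghost edges, outer-corner edges); every other frozen edge is closed. [folklore] -/
def openEdges : Finset ((ℤ × ℤ) × Bool) :=
  M.frozenEdges.filter fun e =>
    (e.1 ∈ M.arcVerts ∧ SixVertex.edgeTip e ∈ M.ghosts) ∨ (SixVertex.edgeTip e ∈ M.arcVerts ∧ e.1 ∈ M.ghosts) ∨
      (e.1 ∉ M.V ∧ SixVertex.edgeTip e ∉ M.V ∧ ∃ p ∈ M.pockets, e ∈ faceEdges p)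

/-! ### Height configurations -/

/-- The height of the vertex-cell `x` in configuration `h` (prescribed value off the free vertices). [cite: BaxterKellandWu1976, medial-lattice ice model (bulk)] -/
def hv (h : ↥M.freeCells → ℤ) (x : ℤ × ℤ) : ℤ :=
  if hx : (x, false) ∈ M.freeCells then h ⟨(x, false), hx⟩ else M.C.vertH x

/-- The height of the face-cell `f` in configuration `h` (prescribed value off the free faces). [cite: BaxterKellandWu1976, medial-lattice ice model (bulk)] -/
def hf (h : ↥M.freeCells → ℤ) (f : ℤ × ℤ) : ℤ :=
  if hx : (f, true) ∈ M.freeCells then h ⟨(f, true), hx⟩ else M.C.faceH f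

/-- Validity of a height assignment: heights of a vertex-cell and a face-cell sharing a corner
differ by exactly one whenever one of the two is free (the ice rule / level-line structure; two
prescribed cells may differ by `2` across a jump edge). [cite: BaxterKellandWu1976, medial-lattice ice model (bulk)] -/
def IsValid (h : ↥M.freeCells → ℤ) : Prop :=
  ∀ x ∈ M.vertexCells, ∀ f ∈ SixVertex.vertexFaces x, f ∈ M.faceCells →
    ((x, false) ∈ M.freeCells ∨ (f, true) ∈ M.freeCells) → |M.hv h x - M.hf h f| = 1

/-- Validity is decidable (finitely many corner pairs). [folklore] -/
instance (h : ↥M.freeCells → ℤ) : Decidable (M.IsValid h) := by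
  unfold IsValid; infer_instance

/-- A bound on all heights: (sup of `|prescribed heights|` over the cells) `+ 2|V| + 2`. Every valid
configuration obeys it (a free cell is within `2|V| + 1` unit steps of a prescribed one along the
north-east diagonal), so filtering by it loses nothing; it makes finiteness manifest. [folklore] -/
def bound : ℕ :=
  M.vertexCells.sup (fun x => (M.C.vertH x).natAbs) + M.faceCells.sup (fun f => (M.C.faceH f).natAbs) +
    2 * M.V.card + 2

/-- The finite set of height configurations: valid assignments of heights in `[-B, B]` to the free
cells. [cite: BaxterKellandWu1976, medial-lattice ice model (bulk)] -/
noncomputable def configs : Finset (↥M.freeCells → ℤ) :=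
  (Fintype.piFinset fun _ : ↥M.freeCells => Finset.Icc (-(M.bound : ℤ)) M.bound).filter fun h => M.IsValid h

/-- The type of height configurations of the model (a `Fintype`). [cite: BaxterKellandWu1976, medial-lattice ice model (bulk)] -/
def HeightConfig : Type := ↥M.configs

/-- Height configurations form a finite type (a subtype of a `Finset` of bounded functions). [folklore] -/
noncomputable instance : Fintype M.HeightConfig := by
  unfold HeightConfig; infer_instance

/-! ### Weights -/

/-- **(B)** the live weight at `e = {x, y} ∈ E` with side faces `f, g`: `c = √3` if
`h x = h y ∧ h f = h g` (both pairings of the strands are consistently oriented: `e^{2iμ} + e^{-2iμ}`),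
else `a = b = 1`. [cite: DKLM2026SixVertexGFF, Def. 2.1] -/
noncomputable def liveWeight (h : ↥M.freeCells → ℤ) (e : (ℤ × ℤ) × Bool) : ℂ :=
  if M.hv h e.1 = M.hv h (SixVertex.edgeTip e) ∧
      M.hf h (SixVertex.leftFace e true) = M.hf h (SixVertex.leftFace e false)
  then ((Real.sqrt 3 : ℝ) : ℂ) else 1

/-- The factor of one endpoint `x` of a frozen CLOSED edge with side faces `f, g`: the strand going
round `x` between `f` and `g` is tracked iff `x, f, g` are cells, consistently oriented iff
`h f = h g`, and then turns by `sign (h x − h f) · 90°`: factor `e^{iμ (h x − h f)}`; otherwise `1`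
(untracked strand, or a defect where two legs end). [cite: BaxterKellandWu1976, medial-lattice ice model (boundary weights)] -/
noncomputable def closedFactor (h : ↥M.freeCells → ℤ) (e : (ℤ × ℤ) × Bool) (x : ℤ × ℤ) : ℂ :=
  if x ∈ M.vertexCells ∧ SixVertex.leftFace e true ∈ M.faceCells ∧ SixVertex.leftFace e false ∈ M.faceCells ∧
      M.hf h (SixVertex.leftFace e true) = M.hf h (SixVertex.leftFace e false)
  then phase (M.hv h x - M.hf h (SixVertex.leftFace e true)) else 1

/-- **(C)/(D1)** the weight of a frozen closed edge: the product of the factors of its two endpoints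
(for an exterior edge `{v, w}`, `v ∈ V`, `w` not a cell, with both faces at collar height `H` this
is `e^{iπ (h v − H)/12}`; for a jump edge it is `1`). [cite: BaxterKellandWu1976, medial-lattice ice model (boundary weights)] -/
noncomputable def closedWeight (h : ↥M.freeCells → ℤ) (e : (ℤ × ℤ) × Bool) : ℂ :=
  M.closedFactor h e e.1 * M.closedFactor h e (SixVertex.edgeTip e)

/-- The factor of one side face `f` of a frozen OPEN edge `{x, y}`: the strand running along `f` is
tracked iff `f, x, y` are cells, consistently oriented iff `h x = h y`, and then contributes
`e^{iμ (h f − h x)}`; otherwise `1`. [cite: BaxterKellandWu1976, medial-lattice ice model (boundary weights)] -/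
noncomputable def openFactor (h : ↥M.freeCells → ℤ) (e : (ℤ × ℤ) × Bool) (f : ℤ × ℤ) : ℂ :=
  if f ∈ M.faceCells ∧ e.1 ∈ M.vertexCells ∧ SixVertex.edgeTip e ∈ M.vertexCells ∧
      M.hv h e.1 = M.hv h (SixVertex.edgeTip e)
  then phase (M.hf h f - M.hv h e.1) else 1

/-- **(D2)** the weight of a frozen open edge (spoke or ghost edge at level `H_w`): the product of
the factors of its two side faces — `e^{2iμ}` if both are at `H_w + 1`, `e^{-2iμ}` if both at
`H_w − 1`, `1` if they differ; `e^{iμ (h p − H_w)}` for the ghost edge under a pocket `p` (its outer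
face is not a cell). [cite: BaxterKellandWu1976, medial-lattice ice model (boundary weights)] -/
noncomputable def openWeight (h : ↥M.freeCells → ℤ) (e : (ℤ × ℤ) × Bool) : ℂ :=
  M.openFactor h e (SixVertex.leftFace e true) * M.openFactor h e (SixVertex.leftFace e false)

/-- The weight of a frozen edge: open rule on `openEdges`, closed rule otherwise. [cite: BaxterKellandWu1976, medial-lattice ice model (boundary weights)] -/
noncomputable def frozenWeight (h : ↥M.freeCells → ℤ) (e : (ℤ × ℤ) × Bool) : ℂ :=
  if e ∈ M.openEdges then M.openWeight h e else M.closedWeight h e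

/-- **The weight of a height configuration**: live six-vertex weights times the collar / wired-arc
phases. [cite: BaxterKellandWu1976, medial-lattice ice model (boundary weights)] -/
noncomputable def weight (h : ↥M.freeCells → ℤ) : ℂ :=
  (∏ e ∈ M.E, M.liveWeight h e) * ∏ e ∈ M.frozenEdges, M.frozenWeight h e

/-- **The partition function** `Z = ∑_h weight h ∈ ℂ` of the collar model (for the closed collar
`CollarData.free H` it equals `2^{|E|}`, the number of bond configurations — BKW with loop weight
`1`; see the module docstring). [cite: BaxterKellandWu1976, medial-lattice ice model (boundary weights)] -/
noncomputable def Z : ℂ := ∑ h ∈ M.configs, M.weight h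

/-- `Z` as a sum over the `Fintype` of height configurations. [folklore] -/
theorem Z_eq_sum_heightConfig : M.Z = ∑ h : M.HeightConfig, M.weight h.1 :=
  (Finset.sum_coe_sort M.configs M.weight).symm

/-! ### Unfolding lemmas: the pinned tables (B), (C), (D1), (D2) -/

/-- (B): c-type ⇒ weight `√3`. [cite: DKLM2026SixVertexGFF, Def. 2.1] -/
theorem liveWeight_of_ctype {h : ↥M.freeCells → ℤ} {e : (ℤ × ℤ) × Bool}
    (hxy : M.hv h e.1 = M.hv h (SixVertex.edgeTip e))
    (hfg : M.hf h (SixVertex.leftFace e true) = M.hf h (SixVertex.leftFace e false)) :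
    M.liveWeight h e = ((Real.sqrt 3 : ℝ) : ℂ) := by
  simp [liveWeight, hxy, hfg]

/-- (B): the vertex heights differ (a/b-type) ⇒ weight `1`. [cite: DKLM2026SixVertexGFF, Def. 2.1] -/
theorem liveWeight_of_hv_ne {h : ↥M.freeCells → ℤ} {e : (ℤ × ℤ) × Bool}
    (hxy : M.hv h e.1 ≠ M.hv h (SixVertex.edgeTip e)) : M.liveWeight h e = 1 := by
  simp [liveWeight, hxy]

/-- (B): the face heights differ (a/b-type, even when `h x = h y`) ⇒ weight `1`. [cite: DKLM2026SixVertexGFF, Def. 2.1] -/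
theorem liveWeight_of_hf_ne {h : ↥M.freeCells → ℤ} {e : (ℤ × ℤ) × Bool}
    (hfg : M.hf h (SixVertex.leftFace e true) ≠ M.hf h (SixVertex.leftFace e false)) :
    M.liveWeight h e = 1 := by
  simp [liveWeight, hfg]

/-- (C): an exterior edge (`x` a vertex-cell, the far endpoint not a cell) whose two faces are cells
at the same height `H = h f` contributes `e^{iπ (h x − H)/12}`. [cite: BaxterKellandWu1976, medial-lattice ice model (boundary weights)] -/
theorem closedWeight_of_eq {h : ↥M.freeCells → ℤ} {e : (ℤ × ℤ) × Bool}
    (hx : e.1 ∈ M.vertexCells) (hy : SixVertex.edgeTip e ∉ M.vertexCells)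
    (hf₁ : SixVertex.leftFace e true ∈ M.faceCells) (hf₂ : SixVertex.leftFace e false ∈ M.faceCells)
    (hH : M.hf h (SixVertex.leftFace e true) = M.hf h (SixVertex.leftFace e false)) :
    M.closedWeight h e = phase (M.hv h e.1 - M.hf h (SixVertex.leftFace e true)) := by
  simp [closedWeight, closedFactor, hx, hy, hf₁, hf₂, hH]

/-- (D1): a jump edge (its two faces at different heights) contributes `1`. [cite: BaxterKellandWu1976, medial-lattice ice model (boundary weights)] -/
theorem closedWeight_of_ne {h : ↥M.freeCells → ℤ} {e : (ℤ × ℤ) × Bool}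
    (hH : M.hf h (SixVertex.leftFace e true) ≠ M.hf h (SixVertex.leftFace e false)) :
    M.closedWeight h e = 1 := by
  simp [closedWeight, closedFactor, hH]

/-- (D2): a frozen open edge between cells at a common height, both of whose side faces are cells,
contributes `e^{iμ (h f − h x)} e^{iμ (h g − h x)}`. [cite: BaxterKellandWu1976, medial-lattice ice model (boundary weights)] -/
theorem openWeight_of_eq {h : ↥M.freeCells → ℤ} {e : (ℤ × ℤ) × Bool}
    (hx : e.1 ∈ M.vertexCells) (hy : SixVertex.edgeTip e ∈ M.vertexCells)
    (hf₁ : SixVertex.leftFace e true ∈ M.faceCells) (hf₂ : SixVertex.leftFace e false ∈ M.faceCells)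
    (hxy : M.hv h e.1 = M.hv h (SixVertex.edgeTip e)) :
    M.openWeight h e = phase (M.hf h (SixVertex.leftFace e true) - M.hv h e.1) *
      phase (M.hf h (SixVertex.leftFace e false) - M.hv h e.1) := by
  simp [openWeight, openFactor, hx, hy, hf₁, hf₂, hxy]

/-- The closed collar has no arc vertices, pockets, ghosts or open edges. [folklore] -/
theorem ofDomain_cells (V : Finset (ℤ × ℤ)) :
    (ofDomain V).arcVerts = ∅ ∧ (ofDomain V).pockets = ∅ ∧ (ofDomain V).ghosts = ∅ ∧
      (ofDomain V).openEdges = ∅ := by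
  have h1 : (ofDomain V).arcVerts = ∅ := by simp [arcVerts, ofDomain, CollarData.free]
  have h2 : (ofDomain V).pockets = ∅ := by simp [pockets, ofDomain, CollarData.free]
  have h3 : (ofDomain V).ghosts = ∅ := by simp [ghosts, h1, h2]
  refine ⟨h1, h2, h3, ?_⟩
  simp [openEdges, h1, h2, h3]

/-! ### (D3) Leg insertions: the counter-clockwise boundary walk and the jump collar -/

/-- The four lattice directions `E, N, W, S` (counter-clockwise order). [folklore] -/
def dir (k : Fin 4) : ℤ × ℤ := ![((1 : ℤ), (0 : ℤ)), (0, 1), (-1, 0), (0, -1)] k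

/-- A dart `(v, k)`: the lattice edge leaving `v` in direction `k`; it is EXTERIOR for `V` when
`v ∈ V` and `v + dir k ∉ V`. [folklore] -/
abbrev Dart : Type := (ℤ × ℤ) × Fin 4

/-- The far endpoint `v + dir k` of a dart (for an exterior dart of an arc vertex: its ghost). [folklore] -/
def dartTip (d : Dart) : ℤ × ℤ := d.1 + dir d.2

/-- The exterior face met counter-clockwise right after the exterior dart `(v, k)`: the face at `v`
in the quadrant between directions `k` and `k + 1`. [folklore] -/
def gapFace (d : Dart) : ℤ × ℤ :=
  ![d.1, (d.1.1 - 1, d.1.2), (d.1.1 - 1, d.1.2 - 1), (d.1.1, d.1.2 - 1)] d.2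

/-- Counter-clockwise successor of an exterior dart `(v, k)` along the boundary of `V`: turn at a
convex corner, go straight, or turn back at a reflex corner. [folklore] -/
def dsucc (V : Finset (ℤ × ℤ)) (d : Dart) : Dart :=
  if d.1 + dir (d.2 + 1) ∉ V then (d.1, d.2 + 1)
  else if d.1 + dir (d.2 + 1) + dir d.2 ∉ V then (d.1 + dir (d.2 + 1), d.2)
  else (d.1 + dir (d.2 + 1) + dir d.2, d.2 + 3)

/-- The exterior dart at a boundary vertex `x` (least direction pointing out of `V`; a non-corner
boundary vertex has exactly one), if any. [folklore] -/
def outDart (V : Finset (ℤ × ℤ)) (x : ℤ × ℤ) : Option Dart :=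
  ((List.finRange 4).find? fun k => decide (x + dir k ∉ V)).map fun k => (x, k)

/-- The length of the boundary cycle through `d` (first return time of `dsucc`, at most `4|V|`;
`0` if none). [folklore] -/
def period (V : Finset (ℤ × ℤ)) (d : Dart) : ℕ :=
  ((List.range (4 * V.card + 1)).find? fun n => decide (0 < n ∧ (dsucc V)^[n] d = d)).getD 0

/-- The boundary cycle of exterior darts starting at `d`, counter-clockwise. [folklore] -/
def cycle (V : Finset (ℤ × ℤ)) (d : Dart) : List Dart :=
  List.iterate (dsucc V) d (period V d)

/-- State of the collar walk: current prescribed level, whether the current stretch is wired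
(equivalently: the level is odd), legs of the current insertion still to be realised, and their
sign (`+1` sink: the level rises, `-1` source: it drops). [folklore] -/
structure WalkState where
  /-- prescribed level of the stretch just walked -/
  level : ℤ
  /-- the stretch just walked is wired -/
  wired : Bool
  /-- legs of the current insertion not yet realised -/
  pending : ℕ
  /-- `+1` at the sink, `-1` at a source -/
  sgn : ℤ
deriving DecidableEq

/-- One exterior dart of the walk. `start` announces an insertion `(L, s)` beginning at this dart.
While legs are pending the dart realises: on a wired stretch a JUNCTION closing the arc (`±1`);
on a free stretch a JUMP EDGE (`±2`) if at least two legs remain, else a junction opening a wired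
arc (`±1`). [folklore] -/
def WalkState.step (s : WalkState) (start : Option (ℕ × ℤ)) : WalkState :=
  let s₁ : WalkState :=
    match start with
    | some (L, σ) => { s with pending := L, sgn := σ }
    | none => s
  if s₁.pending = 0 then s₁
  else if s₁.wired then
    { s₁ with level := s₁.level + s₁.sgn, wired := false, pending := s₁.pending - 1 }
  else if 2 ≤ s₁.pending then
    { s₁ with level := s₁.level + 2 * s₁.sgn, pending := s₁.pending - 2 }
  else { s₁ with level := s₁.level + s₁.sgn, wired := true, pending := s₁.pending - 1 }

/-- **Leg-insertion data**: source points `x ∈ source` with leg numbers `legs x ≥ 1`, and the sink;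
the sink carries `Σ_{sources} legs` legs, so that `Σ_i s_i L_i = 0` holds by construction (all
`s_i = +1` but the sink's `-1`). Points should be distinct non-corner boundary vertices of the
domain (`IsAdmissible`). [folklore] -/
structure LegInsertionData where
  /-- the sources `x_i` (`s_i = +1`) -/
  source : Finset (ℤ × ℤ)
  /-- leg numbers `L_i` of the sources (values off `source` unused) -/
  legs : ℤ × ℤ → ℕ
  /-- the unique sink (`s = -1`) -/
  sink : ℤ × ℤ

namespace LegInsertionData

section Walk

variable (ι : LegInsertionData) (V : Finset (ℤ × ℤ))

/-- The leg number `L = Σ_{sources} L_i` of the sink. [folklore] -/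
def sinkLegs : ℕ := ∑ x ∈ ι.source, ι.legs x

/-- The insertion (leg number, sign) whose footprint starts at the exterior dart `d`, if any. [folklore] -/
def startAt (d : Dart) : Option (ℕ × ℤ) :=
  if outDart V ι.sink = some d then some (ι.sinkLegs, 1)
  else if d.1 ∈ ι.source ∧ outDart V d.1 = some d then some (ι.legs d.1, -1)
  else none

/-- The state just before the sink: level `-L_sink`, wired iff `L_sink` is odd. [folklore] -/
def init : WalkState :=
  ⟨-(ι.sinkLegs : ℤ), ι.sinkLegs % 2 == 1, 0, 0⟩

/-- The annotated counter-clockwise walk from the sink's dart: each exterior dart with the states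
before and after it (empty if the sink has no exterior dart). [folklore] -/
def walk : List (Dart × WalkState × WalkState) :=
  match outDart V ι.sink with
  | none => []
  | some d₀ =>
    let ds := cycle V d₀
    let st := ds.scanl (fun s d => s.step (ι.startAt V d)) ι.init
    ds.zip (st.zip st.tail)

/-- The prescribed vertex level a walk entry assigns to `x`: the wired level, if the dart is on a
wired stretch (before or after it) and `x` is its vertex or its tip (ghost); the level of the
pocket after it, if `x ∉ V` is a corner of that pocket. [folklore] -/
def mention (x : ℤ × ℤ) (t : Dart × WalkState × WalkState) : Option ℤ :=
  if (t.2.1.wired || t.2.2.wired) && (decide (t.1.1 = x) || decide (dartTip t.1 = x)) then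
    some (if t.2.1.wired then t.2.1.level else t.2.2.level)
  else if t.2.2.wired && decide (x ∈ SixVertex.faceCorners (gapFace t.1)) && decide (x ∉ V) then
    some t.2.2.level
  else none

/-- **The jump collar of a leg insertion**: pockets = faces met on wired stretches; arc = vertices
of darts on wired stretches (their tips are the ghosts; reflex corners, having no dart, stay free);
collar faces at the level after their dart; arc vertices and ghosts at their wired level (first
mention along the walk). [folklore] -/
def collar : CollarData where
  faceH f :=
    match (ι.walk V).find? fun t => !t.2.2.wired && decide (gapFace t.1 = f) with
    | some t => t.2.2.level
    | none => 0
  vertH x := ((ι.walk V).findSome? (mention V x)).getD 0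
  arc := (((ι.walk V).filter fun t => t.2.1.wired || t.2.2.wired).map fun t => t.1.1).toFinset
  pocket := (((ι.walk V).filter fun t => t.2.2.wired).map fun t => gapFace t.1).toFinset

/-- The collar model of the insertion on the domain `V`. [folklore] -/
def model : CollarLegModel := ⟨V, ι.collar V⟩

end Walk

/-- Admissibility of leg-insertion data on `V`: at least one source, positive leg numbers, the sink
is not a source, every insertion point is a NON-CORNER boundary vertex (exactly one lattice
neighbour outside `V`) met by the boundary walk from the sink, footprints do not overlap (nothing
pending when an insertion starts) and the walk closes up (final level, wiredness and pending legs
are the initial ones). [folklore] -/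
def IsAdmissible (ι : LegInsertionData) (V : Finset (ℤ × ℤ)) : Prop :=
  ι.source.Nonempty ∧ (∀ x ∈ ι.source, 1 ≤ ι.legs x) ∧ ι.sink ∉ ι.source ∧
  (∀ x ∈ insert ι.sink ι.source, x ∈ V ∧ ((neighbours x).filter fun y => y ∉ V).card = 1 ∧
      ∃ t ∈ ι.walk V, t.1.1 = x) ∧
  (∀ t ∈ ι.walk V, ι.startAt V t.1 ≠ none → t.2.1.pending = 0) ∧
  ((ι.walk V).getLast?.map fun t => (t.2.2.level, t.2.2.wired, t.2.2.pending)) =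
    some (-(ι.sinkLegs : ℤ), ι.sinkLegs % 2 == 1, 0)

/-- Admissibility is decidable. [folklore] -/
instance (ι : LegInsertionData) (V : Finset (ℤ × ℤ)) : Decidable (ι.IsAdmissible V) := by
  unfold IsAdmissible; infer_instance

end LegInsertionData

/-- **`Z_Ω^δ[ins]`**: the (un-normalised, complex) partition function of the collar model with the
leg insertion `ι` on `V` — the sum of the weights over the height configurations of its jump collar.
Its argument is configuration-independent and `|Zins| / 2^{|E|}` is the `P_{1/2}`-probability of
the rainbow hull event of the insertion (validated by enumeration, module docstring; to be proved
where used). [folklore] -/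
noncomputable def Zins (V : Finset (ℤ × ℤ)) (ι : LegInsertionData) : ℂ :=
  (ι.model V).Z

end CollarLegModel

end Literature.Probability.LatticeModels
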